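import Summits.BirchSwinnertonDyer.BirchSwinnertonDyer.Theorems.Rank2ObservatoryPadicSymbolTable
import HarnessLib

/-!
# BirchSwinnertonDyer — rank ≥ 2 observatory: the `L`-datum at measure level `p^{n+1}` with unit-root digits

HONEST FRAMING: per-curve certified theorems and census instruments; no claim on BSD in rank ≥ 2.

Module of the series `Rank2ObservatoryPadic*.lean` (generic squeeze `Rank2ObservatoryPadicRow.lean`,
level-`p²` symbol tables `Rank2ObservatoryPadicSymbolTable.lean`). The general certificate shape
`SymbolCertL = (r, n, A, tabHi, tabLo, H, L)` with its Boolean kernel test `validL p a_p` and the row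
theorem `padicRow_of_symbolCertL` is what the machine-written atlas `Rank2ObservatoryPadicAtlas*.lean`
instantiates at every two-engine cell of the rank-2 census (`n = 1` is the level-`p²` shape of the
previous module with `ΣLo` allowed non-zero; `n = 2, 3` are the cells with `v_p([T²] L_p) ≥ 1`).

## Higher measure level with the digits of `α`: the cells with `v_p([T^r] L_p) ≥ 1`

At measure level `p^{n+1}` the Riemann sum is `RS(r, n) = α^{-(n+1)} (ΣHi_n − α⁻¹ ΣLo_n)/D`
(`padicLRiemannSum_eq_isumL`, the general form of §5), and `ΣLo_n` no longer vanishes, so the unit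
root enters: with an INTEGER `A ≡ α (mod p^n)` — certified inside the kernel by
`p^n ∣ A² − a_p A + p`, `p ∤ A` (`norm_unitRoot_sub_int_le`: `(α − A)(α + A − a_p) = −(A² − a_p A + p)`
and `α + A − a_p = A − β` is a unit) — one has `‖α ΣHi − ΣLo‖ = ‖A ΣHi − ΣLo‖ > p^{-n}` as soon as
`p^n ∤ A ΣHi − ΣLo`, which beats the truncation error `p^{-n}/‖r!‖` (`coeff_ne_zero_of_symbolTableL`).
`SymbolCertL = (r, n, A, tabHi, tabLo, H, L)` with the Boolean test `validL p a_p` packages it; the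
three cells of conductor `< 600` left open by §6 — `(446d1, 5)`, `(563a1, 5)` (anomalous) and
`(446d1, 7)` — are certified at `n = 2` (tables of `p³ = 125, 125, 343` numerators; in all three
`v_p(A ΣHi − ΣLo) = 1`, matching the engines' `[T²] = p · unit`). With §4–§6 this makes the `p`-adic
row a kernel-checked certificate at ALL 19 two-engine cells of the rank-2 curves of conductor `< 600`.
Tables: engine A (`symcert/symtab_hi.json`, generator `symcert/gen_block3.py`).
[cite: MazurTateTeitelbaum1986Invent, §I.10–I.13] [cite: SteinWuthrich2013, §3]
-/

-- single-conjunct summit: `Summit.BirchSwinnertonDyer.BirchSwinnertonDyer.…` repeats the name by design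
set_option linter.dupNamespace false

noncomputable section

open scoped Classical

namespace Summit.BirchSwinnertonDyer.BirchSwinnertonDyer.Rank2Observatory

open scoped MatrixGroups ModularForm
open CongruenceSubgroup Literature.NumberTheory.EllipticCurves
  Literature.NumberTheory.EllipticCurves.ModularForms WeierstrassCurve

section HigherLevel

variable (p : ℕ) [Fact p.Prime]

/-- The INTEGER double sum at measure level `p^{n+1}`:
`Σ_{y ∈ teichSet p (n+1)} Σ_{s mod p^n} tab[(y (1+p)^s mod p^{n+1})] · C(s, k)` (computable; `decide`).
[folklore] -/
def isumL (n : ℕ) (tab : List ℤ) (k : ℕ) : ℤ :=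
  ∑ y ∈ teichSet p (n + 1), ∑ s : ZMod (p ^ n),
    tab.getD ((y * ((1 + p : ℕ) : ZMod (p ^ (n + 1))) ^ s.val).val) 0 * (s.val.choose k : ℤ)

/-- **The level-`p^{n+1}` Riemann sum from a plus-symbol table** (odd `p`; general form of
`padicLRiemannSum_one_eq`): if `[u/p^{n+1}]⁺ = tabHi[u]/D` and `[u/p^n]⁺ = tabLo[u]/D` at the unit
residues `u mod p^{n+1}`, then `RS(k, n) = α^{-(n+1)} isumL(tabHi)/D − α^{-(n+2)} isumL(tabLo)/D`.
[cite: MazurTateTeitelbaum1986Invent, §I.10 (10.1), §I.13] -/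
theorem padicLRiemannSum_eq_isumL {N : ℕ} (f : CuspForm (Gamma0 N) 2) (α : ℚ_[p]) (k n : ℕ)
    (hp2 : p ≠ 2) (tabHi tabLo : List ℤ) (D : ℚ)
    (hcard : (teichSet p (n + 1)).card = torsionOrder p)
    (hunit : ∀ y ∈ teichSet p (n + 1), ∀ s : ZMod (p ^ n),
      ¬ p ∣ (y * ((1 + p : ℕ) : ZMod (p ^ (n + 1))) ^ s.val).val)
    (htab : ∀ u : ℕ, u < p ^ (n + 1) → ¬ p ∣ u →
      ratPlusSymbol f ((u : ℚ) / (p : ℚ) ^ (n + 1)) = (tabHi.getD u 0 : ℚ) / D ∧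
      ratPlusSymbol f ((u : ℚ) / (p : ℚ) ^ n) = (tabLo.getD u 0 : ℚ) / D) :
    padicLRiemannSum f α k n =
      α⁻¹ ^ (n + 1) * ((((isumL p n tabHi k : ℤ) : ℚ) / D : ℚ) : ℚ_[p]) -
        α⁻¹ ^ (n + 2) * ((((isumL p n tabLo k : ℤ) : ℚ) / D : ℚ) : ℚ_[p]) := by
  have he : cyclotomicExponent p = 1 := if_neg hp2
  have hγ : cyclotomicGenerator p = 1 + p := by simp [cyclotomicGenerator, he]
  unfold padicLRiemannSum
  rw [hγ]
  generalize hm : n + cyclotomicExponent p = m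
  obtain rfl : m = n + 1 := by omega
  rw [finsum_rootsOfUnity_eq_sum_teichSet p (n + 1) (by omega) hcard
    (fun y => ∑ s : ZMod (p ^ n), msdMeasure f α (n + 1)
      (y * ((1 + p : ℕ) : ZMod (p ^ (n + 1))) ^ s.val) * (s.val.choose k : ℚ_[p]))]
  have hval : ∀ y ∈ teichSet p (n + 1), ∀ s : ZMod (p ^ n),
      msdMeasure f α (n + 1) (y * ((1 + p : ℕ) : ZMod (p ^ (n + 1))) ^ s.val) =
        α⁻¹ ^ (n + 1) *
            (((tabHi.getD ((y * ((1 + p : ℕ) : ZMod (p ^ (n + 1))) ^ s.val).val) 0 : ℚ) / D : ℚ) :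
              ℚ_[p]) -
          α⁻¹ ^ (n + 2) *
            (((tabLo.getD ((y * ((1 + p : ℕ) : ZMod (p ^ (n + 1))) ^ s.val).val) 0 : ℚ) / D : ℚ) :
              ℚ_[p]) := by
    intro y hy s
    set u := y * ((1 + p : ℕ) : ZMod (p ^ (n + 1))) ^ s.val with hu
    obtain ⟨h2, h1⟩ := htab u.val (ZMod.val_lt u) (hunit y hy s)
    show α⁻¹ ^ (n + 1) * (ratPlusSymbol f ((u.val : ℚ) / (p : ℚ) ^ (n + 1)) : ℚ_[p]) -
      α⁻¹ ^ (n + 2) * (ratPlusSymbol f ((u.val : ℚ) / (p : ℚ) ^ n) : ℚ_[p]) = _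
    rw [h2, h1]
  rw [Finset.sum_congr rfl fun y hy => Finset.sum_congr rfl fun s _ => by rw [hval y hy s]]
  have hR : ∀ tab : List ℤ,
      (∑ y ∈ teichSet p (n + 1), ∑ s : ZMod (p ^ n),
        (((tab.getD ((y * ((1 + p : ℕ) : ZMod (p ^ (n + 1))) ^ s.val).val) 0 : ℚ) / D : ℚ) :
            ℚ_[p]) * (s.val.choose k : ℚ_[p])) =
          ((((isumL p n tab k : ℤ) : ℚ) / D : ℚ) : ℚ_[p]) := by
    intro tab
    simp only [isumL]
    push_cast
    rw [Finset.sum_div]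
    refine Finset.sum_congr rfl fun y _ => ?_
    rw [Finset.sum_div]
    refine Finset.sum_congr rfl fun s _ => ?_
    ring
  simp only [sub_mul, Finset.sum_sub_distrib, mul_assoc, ← Finset.mul_sum, hR]

/-- **Digits of the unit root, certified by a congruence.** If an integer `A` prime to `p` satisfies
`A² − a_p A + p ≡ 0 (mod p^M)` then `‖α − A‖ ≤ p^{-M}` for the unit root `α` of a good ordinary `p`:
`(α − A)(α + A − a_p) = −(A² − a_p A + p)` and `α + A − a_p = A − β` with `‖β‖ = ‖p/α‖ < 1 = ‖A‖`.
[cite: MazurTateTeitelbaum1986Invent, §I.11] -/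
theorem norm_unitRoot_sub_int_le (W : WeierstrassCurve ℚ) [W.IsElliptic] [W.IsGloballyMinimal]
    (hord : IsOrdinaryAt W p) (A : ℤ) (M : ℕ)
    (hA : (p : ℤ) ^ M ∣ A ^ 2 - W.frobeniusTrace p * A + p) (hAu : ¬ (p : ℤ) ∣ A) :
    ‖(unitRoot W p : ℚ_[p]) - (A : ℚ_[p])‖ ≤ (p : ℝ) ^ (-(M : ℤ)) := by
  obtain ⟨hspec, -⟩ := unitRoot_spec_holds W p hord
  have hα : ‖(unitRoot W p : ℚ_[p])‖ = 1 := norm_unitRoot_holds W p hord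
  set α : ℚ_[p] := (unitRoot W p : ℚ_[p]) with hαdef
  have hspec' : α ^ 2 - ((W.frobeniusTrace p : ℤ) : ℚ_[p]) * α + p = 0 := by
    have h := congr_arg ((↑) : ℤ_[p] → ℚ_[p]) hspec
    simpa using h
  have hkey : (α - A) * (α + A - ((W.frobeniusTrace p : ℤ) : ℚ_[p])) =
      -(((A ^ 2 - W.frobeniusTrace p * A + p : ℤ)) : ℚ_[p]) := by
    push_cast
    linear_combination hspec'
  have hint : ‖(((A ^ 2 - W.frobeniusTrace p * A + p : ℤ)) : ℚ_[p])‖ ≤ (p : ℝ) ^ (-(M : ℤ)) :=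
    (Padic.norm_int_le_pow_iff_dvd _ _).mpr hA
  have hp1 : (1 : ℝ) < p := by exact_mod_cast (Fact.out : p.Prime).one_lt
  have hβ : ‖((W.frobeniusTrace p : ℤ) : ℚ_[p]) - α‖ < 1 := by
    have h1 : α * (((W.frobeniusTrace p : ℤ) : ℚ_[p]) - α) = p := by linear_combination -hspec'
    have h2 : ‖α‖ * ‖((W.frobeniusTrace p : ℤ) : ℚ_[p]) - α‖ = ‖(p : ℚ_[p])‖ := by
      rw [← norm_mul, h1]
    rw [hα, one_mul, Padic.norm_p] at h2
    rw [h2]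
    exact inv_lt_one_of_one_lt₀ hp1
  have hAnorm : ‖(A : ℚ_[p])‖ = 1 := by
    have hle := Padic.norm_int_le_one (p := p) A
    have hlt : ¬ ‖(A : ℚ_[p])‖ < 1 := by rwa [Padic.norm_intCast_lt_one_iff]
    exact le_antisymm hle (not_lt.mp hlt)
  have hsum : ‖α + A - ((W.frobeniusTrace p : ℤ) : ℚ_[p])‖ = 1 := by
    have : α + A - ((W.frobeniusTrace p : ℤ) : ℚ_[p]) =
        (A : ℚ_[p]) + -(((W.frobeniusTrace p : ℤ) : ℚ_[p]) - α) := by ring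
    rw [this, Padic.add_eq_max_of_ne (by rw [norm_neg, hAnorm]; exact hβ.ne'), norm_neg, hAnorm,
      max_eq_left hβ.le]
  calc ‖α - A‖ = ‖α - A‖ * ‖α + A - ((W.frobeniusTrace p : ℤ) : ℚ_[p])‖ := by rw [hsum, mul_one]
    _ = ‖(α - A) * (α + A - ((W.frobeniusTrace p : ℤ) : ℚ_[p]))‖ := (norm_mul _ _).symm
    _ = ‖(((A ^ 2 - W.frobeniusTrace p * A + p : ℤ)) : ℚ_[p])‖ := by rw [hkey, norm_neg]
    _ ≤ _ := hint

/-- **`[T^r] L_p ≠ 0` from a level-`p^{n+1}` symbol table and the digits of `α`** (odd good ordinary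
`p`, `p ∤ r!`): with `A ≡ α (mod p^n)` (`hA`, `hAu`) and `p^n ∤ A·ΣHi − ΣLo` (`hHL`) one gets
`‖RS(r, n)‖ = ‖α ΣHi − ΣLo‖ = ‖A ΣHi − ΣLo‖ > p^{-n} = ` the truncation error, so
`coeff_ne_zero_of_riemannSum_certificate` (`C = 1` by `hint`) applies.
[cite: MazurTateTeitelbaum1986Invent, §I.10–I.13] [cite: SteinWuthrich2013, §3] -/
theorem coeff_ne_zero_of_symbolTableL (hp2 : p ≠ 2) (W : WeierstrassCurve ℚ) [W.IsElliptic]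
    [W.IsGloballyMinimal] {N : ℕ} [NeZero N] {f : CuspForm (Gamma0 N) 2}
    (hord : IsOrdinaryAt W p) (hf : IsNewformOf W f) {r : ℕ} (hr : ¬ p ∣ r.factorial) (n : ℕ)
    (tabHi tabLo : List ℤ) (D : ℚ) (hD : ‖(D : ℚ_[p])‖ = 1) (H L A : ℤ)
    (hA : (p : ℤ) ^ n ∣ A ^ 2 - W.frobeniusTrace p * A + p) (hAu : ¬ (p : ℤ) ∣ A)
    (hHL : ¬ (p : ℤ) ^ n ∣ A * H - L)
    (hcard : (teichSet p (n + 1)).card = torsionOrder p)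
    (hunit : ∀ y ∈ teichSet p (n + 1), ∀ s : ZMod (p ^ n),
      ¬ p ∣ (y * ((1 + p : ℕ) : ZMod (p ^ (n + 1))) ^ s.val).val)
    (hHi : isumL p n tabHi r = H) (hLo : isumL p n tabLo r = L)
    (hint : ∀ x : ℚ, ‖(ratPlusSymbol f x : ℚ_[p])‖ ≤ 1)
    (htab : ∀ u : ℕ, u < p ^ (n + 1) → ¬ p ∣ u →
      ratPlusSymbol f ((u : ℚ) / (p : ℚ) ^ (n + 1)) = (tabHi.getD u 0 : ℚ) / D ∧
      ratPlusSymbol f ((u : ℚ) / (p : ℚ) ^ n) = (tabLo.getD u 0 : ℚ) / D) :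
    PowerSeries.coeff r (padicLFunction f (unitRoot W p : ℚ_[p])) ≠ 0 := by
  have hα : ‖(unitRoot W p : ℚ_[p])‖ = 1 := norm_unitRoot_holds W p hord
  have hαA := norm_unitRoot_sub_int_le p W hord A n hA hAu
  set α : ℚ_[p] := (unitRoot W p : ℚ_[p]) with hαdef
  have hα0 : α ≠ 0 := fun h => by rw [h, norm_zero] at hα; exact zero_ne_one hα
  have hD0 : (D : ℚ_[p]) ≠ 0 := fun h => by rw [h, norm_zero] at hD; exact zero_ne_one hD
  refine coeff_ne_zero_of_riemannSum_certificate W p hord hf (C := 1)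
    (norm_msdMeasure_le_one p f _ hα hint) (n := n) ?_
  rw [padicLRiemannSum_eq_isumL p f _ r n hp2 tabHi tabLo D hcard hunit htab, hHi, hLo]
  have hfac : ‖((r.factorial : ℕ) : ℚ_[p])‖ = 1 := by
    rw [Padic.norm_natCast_eq_one_iff]
    exact (Nat.Prime.coprime_iff_not_dvd Fact.out).mpr hr
  rw [hfac, div_one, one_mul]
  have hαinv : α⁻¹ * α = 1 := inv_mul_cancel₀ hα0
  have hfactor : α⁻¹ ^ (n + 1) * ((((H : ℤ) : ℚ) / D : ℚ) : ℚ_[p]) -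
      α⁻¹ ^ (n + 2) * ((((L : ℤ) : ℚ) / D : ℚ) : ℚ_[p]) =
        α⁻¹ ^ (n + 2) * ((D : ℚ_[p]))⁻¹ * (α * H - L) := by
    push_cast [Rat.cast_div]
    rw [div_eq_mul_inv, div_eq_mul_inv]
    linear_combination (-(α⁻¹ ^ (n + 1) * ((H : ℤ) : ℚ_[p]) * ((D : ℚ_[p]))⁻¹)) * hαinv
  rw [hfactor, norm_mul, norm_mul, norm_pow, norm_inv, hα, inv_one, one_pow, one_mul, norm_inv, hD,
    inv_one, one_mul]
  have h1 : ¬ ‖(((A * H - L : ℤ)) : ℚ_[p])‖ ≤ (p : ℝ) ^ (-(n : ℤ)) := by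
    rw [Padic.norm_int_le_pow_iff_dvd]; exact hHL
  have h2 : ‖(α - A) * (H : ℚ_[p])‖ ≤ (p : ℝ) ^ (-(n : ℤ)) := by
    rw [norm_mul]
    calc ‖α - A‖ * ‖((H : ℤ) : ℚ_[p])‖ ≤ (p : ℝ) ^ (-(n : ℤ)) * 1 :=
          mul_le_mul hαA (Padic.norm_int_le_one H) (norm_nonneg _) (zpow_nonneg (Nat.cast_nonneg _) _)
      _ = _ := mul_one _
  have hsplit : α * H - L = (((A * H - L : ℤ)) : ℚ_[p]) + (α - A) * H := by push_cast; ring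
  rw [hsplit, Padic.add_eq_max_of_ne (ne_of_gt (lt_of_le_of_lt h2 (not_le.mp h1)))]
  exact lt_max_of_lt_left (not_le.mp h1)

/-- A level-`p^{n+1}` SYMBOL-TABLE CERTIFICATE WITH UNIT-ROOT DIGITS: order `r`, level `n`, an integer
`A ≡ α (mod p^n)`, the numerators of `D·[u/p^{n+1}]⁺` and `D·[u/p^n]⁺` (`u < p^{n+1}`), and the claimed
sums `H = ΣHi`, `L = ΣLo`. [cite: MazurTateTeitelbaum1986Invent, §I.10–I.13] -/
structure SymbolCertL where
  /-- the order of vanishing being certified -/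
  r : ℕ
  /-- the level: Riemann sum `RS(r, n)` at measure level `p^{n+1}` -/
  n : ℕ
  /-- an integer congruent to the unit root `α` modulo `p^n` -/
  A : ℤ
  /-- numerators of `D·[u/p^{n+1}]⁺`, `u = 0 … p^{n+1} − 1` (`0` at non-units) -/
  tabHi : List ℤ
  /-- numerators of `D·[u/p^n]⁺`, `u = 0 … p^{n+1} − 1` (period `p^n`; `0` at non-units) -/
  tabLo : List ℤ
  /-- the integer double sum `ΣHi` -/
  H : ℤ
  /-- the integer double sum `ΣLo` -/
  L : ℤ

/-- The Boolean VALIDITY test of a `SymbolCertL` at the prime `p` with Frobenius trace `ap`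
(kernel-evaluated): `p ≠ 2`, `p ∤ r!`, `p^n ∣ A² − ap·A + p`, `p ∤ A`, `p^n ∤ A·H − L`,
`#teichSet p (n+1) = τ`, unit classes, `ΣHi = H`, `ΣLo = L`. [cite: MazurTateTeitelbaum1986Invent, §I.10–I.13] -/
def SymbolCertL.validL (ap : ℤ) (c : SymbolCertL) : Bool :=
  decide (p ≠ 2 ∧ ¬ p ∣ c.r.factorial ∧ (p : ℤ) ^ c.n ∣ c.A ^ 2 - ap * c.A + p ∧ ¬ (p : ℤ) ∣ c.A ∧
    ¬ (p : ℤ) ^ c.n ∣ c.A * c.H - c.L ∧ (teichSet p (c.n + 1)).card = torsionOrder p ∧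
    (∀ y ∈ teichSet p (c.n + 1), ∀ s : ZMod (p ^ c.n),
      ¬ p ∣ (y * ((1 + p : ℕ) : ZMod (p ^ (c.n + 1))) ^ s.val).val) ∧
    isumL p c.n c.tabHi c.r = c.H ∧ isumL p c.n c.tabLo c.r = c.L)

/-- **`[T^r] L_p ≠ 0` from a VALID `SymbolCertL`** (`coeff_ne_zero_of_symbolTableL` with the decidable
side conditions bundled; `hap` identifies the Frobenius trace used in the congruence for `A`).
[cite: MazurTateTeitelbaum1986Invent, §I.10–I.13] [cite: SteinWuthrich2013, §3] -/
theorem coeff_ne_zero_of_symbolCertL (W : WeierstrassCurve ℚ) [W.IsElliptic] [W.IsGloballyMinimal]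
    {N : ℕ} [NeZero N] {f : CuspForm (Gamma0 N) 2} (hord : IsOrdinaryAt W p) (hf : IsNewformOf W f)
    {ap : ℤ} (hap : W.frobeniusTrace p = ap) (c : SymbolCertL) (hc : c.validL p ap = true) (D : ℚ)
    (hD : ‖(D : ℚ_[p])‖ = 1) (hint : ∀ x : ℚ, ‖(ratPlusSymbol f x : ℚ_[p])‖ ≤ 1)
    (htab : ∀ u : ℕ, u < p ^ (c.n + 1) → ¬ p ∣ u →
      ratPlusSymbol f ((u : ℚ) / (p : ℚ) ^ (c.n + 1)) = (c.tabHi.getD u 0 : ℚ) / D ∧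
      ratPlusSymbol f ((u : ℚ) / (p : ℚ) ^ c.n) = (c.tabLo.getD u 0 : ℚ) / D) :
    PowerSeries.coeff c.r (padicLFunction f (unitRoot W p : ℚ_[p])) ≠ 0 := by
  obtain ⟨hp2, hr, hA, hAu, hHL, hcard, hunit, hHi, hLo⟩ := of_decide_eq_true hc
  rw [← hap] at hA
  exact coeff_ne_zero_of_symbolTableL p hp2 W hord hf hr c.n c.tabHi c.tabLo D hD c.H c.L c.A hA hAu
    hHL hcard hunit hHi hLo hint htab

/-- **The `p`-adic row from a VALID `SymbolCertL`** (as `padicRow_of_symbolCert`, at measure level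
`p^{n+1}` with the digits of `α`). [cite: BalakrishnanMullerStein2015, Thm. 1.7]
[cite: Kato2004Asterisque, Thm. 17.4 (p. 273)] [cite: MazurTateTeitelbaum1986Invent, §I.10–I.13] -/
theorem padicRow_of_symbolCertL (hPRS : Schneider1985_order_charGenerator) (W : WeierstrassCurve ℚ)
    [W.IsElliptic] [W.IsGloballyMinimal] (h5 : 5 ≤ p) (hord : IsOrdinaryAt W p) {ap : ℤ}
    (hap : W.frobeniusTrace p = ap) {N : ℕ} [NeZero N] {f : CuspForm (Gamma0 N) 2}
    (hf : IsNewformOf W f)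
    (hkato : ∀ (κ : ZpExtension ℚ p) (γ : Field.absoluteGaloisGroup ℚ),
      kato_divisibility W p (κ := κ) (γ := γ) (f := f))
    (c : SymbolCertL) (hc : c.validL p ap = true) (hlow : c.r ≤ W.mordellWeilRank) (D : ℚ)
    (hD : ‖(D : ℚ_[p])‖ = 1) (hint : ∀ x : ℚ, ‖(ratPlusSymbol f x : ℚ_[p])‖ ≤ 1)
    (htab : ∀ u : ℕ, u < p ^ (c.n + 1) → ¬ p ∣ u →
      ratPlusSymbol f ((u : ℚ) / (p : ℚ) ^ (c.n + 1)) = (c.tabHi.getD u 0 : ℚ) / D ∧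
      ratPlusSymbol f ((u : ℚ) / (p : ℚ) ^ c.n) = (c.tabLo.getD u 0 : ℚ) / D) :
    W.mordellWeilRank = c.r ∧ (padicLFunction f (unitRoot W p : ℚ_[p])).order = c.r ∧
      Finite (AddCommGroup.primaryComponent W.sha p) ∧
      (∀ Dh : PAdicHeightData W p, Dh.IsCanonical → SchneiderConjecture Dh) ∧
      W.selmerCorank p = c.r := by
  have hLp := coeff_ne_zero_of_symbolCertL p W hord hf hap c hc D hD hint htab
  obtain ⟨hr, ho, hfin, hS⟩ := padicRow_of_certificate hPRS W p hkato h5 hord hf hlow hLp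
  exact ⟨hr, ho, hfin, hS, selmerCorank_eq_of_certificate hPRS W p hkato h5 hord hf hlow hLp⟩

end HigherLevel

end Summit.BirchSwinnertonDyer.BirchSwinnertonDyer.Rank2Observatory

end
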